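import Literature.Barriers.Parity.SiegelZeroDichotomyPairHLMainTermReduction
import HarnessLib

/-!
# Tao–Teräväinen 2022, §8 (`k = 2`): summing the pointwise bound over `n ≤ x`

Topic `Literature/Barriers/Parity`, sub-namespace `TaoTeravainen`; assembly step of Proposition 8.1
in the proof DAG of `Literature.Barriers.Parity.TaoTeravainen2021_prop72_81_pair` (T. Tao, J. Teräväinen,
*The Hardy–Littlewood–Chowla conjecture in the presence of a Siegel zero*, J. London Math. Soc. (2) 106
(2022), arXiv:2109.06291), §8: "The contribution of those `y` with `y ≤ x^{1-ε₀²}` is bounded by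
`x^{-ε₀²} log^{O(1)} x ∑ ∏ 1_{(d_i,d_j)∣h_i-h_j}/[d₁,…,d_k] τ(d₁)^{O(1)}⋯` … this contribution is `≈ 0`.
Thus it will suffice to establish the pointwise bound (8.8) … for all `x^{1-ε₀²} ≤ y ≤ x`."
Everything here is PROVED; the pointwise bound (8.8) on the bulk enters as a hypothesis:

* `abs_sum_sub_mul_le_of_pointwise` — if `|G(n) − 𝔖| ≤ ε` for `x₁ < n ≤ x` and `|G(n)| ≤ M` for
  `n ≤ x₁`, then `|∑_{n≤x} G(n) − 𝔖 x| ≤ ε x + (M + |𝔖|) x₁`;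
* **`abs_sharpCorr_sub_singular_mul_le`** — combining with `abs_sharpCorr_sub_smooth_le`
  (`…TypeIChar.lean`) and `abs_smoothCorr_sub_sum_pointwise_le`, `abs_smoothPointwise_le`
  (`…MainTermReduction.lean`): `|∑_{n≤x} Λ♯(n+h₁)Λ♯(n+h₂) − 𝔖 x| ≤ E_χ + E_CRT + ε x + (M_crude + |𝔖|) x₁`.
  [cite: TaoTeravainen2021, §8 (8.5)–(8.8)]
-/

noncomputable section

open Finset Real

namespace Literature.Barriers.Parity

namespace TaoTeravainen

variable {q : ℕ}

/-- **Summing a pointwise bound**: if `|G(n) − S| ≤ ε` for `x₁ < n ≤ x` and `|G(n)| ≤ M` for `1 ≤ n ≤ x₁`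
(`x₁ ≤ x`), then `|∑_{n=1}^{x} G(n) − S x| ≤ ε x + (M + |S|) x₁`. [cite: TaoTeravainen2021, §8 ("The
contribution of those `y` with `y ≤ x^{1−ε₀²}` … is `≈ 0`")] -/
theorem abs_sum_sub_mul_le_of_pointwise (G : ℕ → ℝ) {S ε M : ℝ} {x₁ x : ℕ} (hx₁ : x₁ ≤ x) (hε : 0 ≤ ε)
    (hbulk : ∀ n ∈ Icc (x₁ + 1) x, |G n - S| ≤ ε) (hcrude : ∀ n ∈ Icc 1 x₁, |G n| ≤ M) :
    |∑ n ∈ Icc 1 x, G n - S * x| ≤ ε * x + (M + |S|) * x₁ := by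
  have hsplit : Icc 1 x = Icc 1 x₁ ∪ Icc (x₁ + 1) x := by
    ext n; simp only [mem_Icc, mem_union]; omega
  have hdisj : Disjoint (Icc 1 x₁) (Icc (x₁ + 1) x) := by
    rw [disjoint_left]; intro n h1 h2; rw [mem_Icc] at h1 h2; omega
  have hcard : ((Icc (x₁ + 1) x).card : ℝ) = x - x₁ := by
    rw [Nat.card_Icc, Nat.cast_sub (by omega)]; push_cast; ring
  have h1 : |∑ n ∈ Icc (x₁ + 1) x, (G n - S)| ≤ ε * (x - x₁) := by
    calc |∑ n ∈ Icc (x₁ + 1) x, (G n - S)| ≤ ∑ n ∈ Icc (x₁ + 1) x, |G n - S| := abs_sum_le_sum_abs _ _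
      _ ≤ ∑ _n ∈ Icc (x₁ + 1) x, ε := sum_le_sum hbulk
      _ = ε * (x - x₁) := by rw [sum_const, nsmul_eq_mul, hcard]; ring
  have h2 : |∑ n ∈ Icc 1 x₁, (G n - S)| ≤ (M + |S|) * x₁ := by
    calc |∑ n ∈ Icc 1 x₁, (G n - S)| ≤ ∑ n ∈ Icc 1 x₁, |G n - S| := abs_sum_le_sum_abs _ _
      _ ≤ ∑ _n ∈ Icc 1 x₁, (M + |S|) := sum_le_sum fun n hn => (abs_sub _ _).trans (add_le_add (hcrude n hn) le_rfl)
      _ = (M + |S|) * x₁ := by rw [sum_const, nsmul_eq_mul, Nat.card_Icc, Nat.add_sub_cancel]; ring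
  have hrew : ∑ n ∈ Icc 1 x, G n - S * x = ∑ n ∈ Icc 1 x₁, (G n - S) + ∑ n ∈ Icc (x₁ + 1) x, (G n - S) := by
    rw [← sum_union hdisj, ← hsplit, sum_sub_distrib, sum_const, nsmul_eq_mul, Nat.card_Icc, Nat.add_sub_cancel]
    ring
  rw [hrew]
  calc |∑ n ∈ Icc 1 x₁, (G n - S) + ∑ n ∈ Icc (x₁ + 1) x, (G n - S)|
      ≤ (M + |S|) * x₁ + ε * (x - x₁) := (abs_add_le _ _).trans (add_le_add h2 h1)
    _ ≤ ε * x + (M + |S|) * x₁ := by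
        have : 0 ≤ ε * x₁ := by positivity
        nlinarith

/-- **`|∑_{n≤x} Λ♯(n+h₁)Λ♯(n+h₂) − 𝔖 x|`** from the four reductions: the `χ`-twisted terms (`E_χ`, the
bound of `abs_sharpCorr_sub_smooth_le`), Lemma 3.3 with summation by parts (`E_CRT`), the pointwise bound
(8.8) on the bulk `x₁ < n ≤ x` (hypothesis `hbulk`), and the crude bound below `x₁`.
[cite: TaoTeravainen2021, §8 (8.5)–(8.8)] -/
theorem abs_sharpCorr_sub_singular_mul_le (χ : DirichletCharacter ℂ q) (φ ψ : ℝ → ℝ) (X U₀ R : ℝ)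
    (h₁ h₂ Dmax : ℕ) {x₁ x : ℕ} (hx₁ : x₁ ≤ x) {S Eχ Ecrt ε Mcrude : ℝ} (hε : 0 ≤ ε)
    (hχ : |∑ n ∈ Icc 1 x, vonMangoldtSiegelSharp χ φ ψ X U₀ R (n + h₁) * vonMangoldtSiegelSharp χ φ ψ X U₀ R (n + h₂) -
        ∑ n ∈ Icc 1 x, (sharpB χ φ ψ X U₀ Dmax (n + h₁) * selbergSieve ψ R (n + h₁)) *
          (sharpB χ φ ψ X U₀ Dmax (n + h₂) * selbergSieve ψ R (n + h₂))| ≤ Eχ)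
    (hcrt : |∑ n ∈ Icc 1 x, (sharpB χ φ ψ X U₀ Dmax (n + h₁) * selbergSieve ψ R (n + h₁)) *
          (sharpB χ φ ψ X U₀ Dmax (n + h₂) * selbergSieve ψ R (n + h₂)) -
        ∑ n ∈ Icc 1 x, smoothPointwise χ φ ψ X U₀ R h₁ h₂ Dmax n| ≤ Ecrt)
    (hbulk : ∀ n ∈ Icc (x₁ + 1) x, |smoothPointwise χ φ ψ X U₀ R h₁ h₂ Dmax n - S| ≤ ε)
    (hcrude : ∀ n ∈ Icc 1 x₁, |smoothPointwise χ φ ψ X U₀ R h₁ h₂ Dmax n| ≤ Mcrude) :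
    |∑ n ∈ Icc 1 x, vonMangoldtSiegelSharp χ φ ψ X U₀ R (n + h₁) * vonMangoldtSiegelSharp χ φ ψ X U₀ R (n + h₂) -
        S * x| ≤ Eχ + Ecrt + (ε * x + (Mcrude + |S|) * x₁) := by
  have h3 := abs_sum_sub_mul_le_of_pointwise (fun n => smoothPointwise χ φ ψ X U₀ R h₁ h₂ Dmax n) hx₁ hε hbulk hcrude
  calc _ ≤ |∑ n ∈ Icc 1 x, vonMangoldtSiegelSharp χ φ ψ X U₀ R (n + h₁) * vonMangoldtSiegelSharp χ φ ψ X U₀ R (n + h₂) -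
          ∑ n ∈ Icc 1 x, (sharpB χ φ ψ X U₀ Dmax (n + h₁) * selbergSieve ψ R (n + h₁)) *
            (sharpB χ φ ψ X U₀ Dmax (n + h₂) * selbergSieve ψ R (n + h₂))| +
        |∑ n ∈ Icc 1 x, (sharpB χ φ ψ X U₀ Dmax (n + h₁) * selbergSieve ψ R (n + h₁)) *
            (sharpB χ φ ψ X U₀ Dmax (n + h₂) * selbergSieve ψ R (n + h₂)) - S * x| := abs_sub_le _ _ _
    _ ≤ Eχ + (Ecrt + (ε * x + (Mcrude + |S|) * x₁)) := by
        refine add_le_add hχ ((abs_sub_le _ (∑ n ∈ Icc 1 x, smoothPointwise χ φ ψ X U₀ R h₁ h₂ Dmax n) _).trans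
          (add_le_add hcrt h3))
    _ = _ := by ring

end TaoTeravainen

end Literature.Barriers.Parity
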